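import Summits.QuantumFields.YangMills.Theorems.BalabanUVNodesN16AtRRec12On
import Summits.QuantumFields.YangMills.Theorems.BalabanUVNodesN16HolderDefs
import HarnessLib

/-!
# Route «BalabanUVNodes», cluster K4 «SpineRates» — node N16 = NE3: THE β-ANALOGUE OF THE STUB, `S_N16Holder β`, AT THE STAGE-12 HOMES OF RECORD —
# master faces at `RRec₁₂On 𝔯 Rg` ∕ `RRec₁₂ 𝔯`, the constant-layer form, the named reading of record `readingOfRecord₁₂ w1 ℓ₃ ne2 ne1` (N21's face: the
# β-root `CovRootHolder` at RR-1's period, letters and data), regime monotonicity, and the `β ≤ 1` WEAKENING from the stub of record at the homes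

Cell `pub-ymgap`, seat `pub-ymgap-dag-n16-e` (R134 acceleration seat (a), strategy s2 = BY-NAME KNIT at the record; HUMAN RULING D-0062; chair R424 venue),
generation 4, file 15 (THEOREMS ONLY, 0 `def`, 0 `sorry`, standard axioms).  `bears_on: R4∕N16 · K3′ SpineGivenEndpointR12 (stmt-QuantumFields-19908)`.  Filed
`--supports stmt-QuantumFields-19908 --as helper`.  Imports this seat's file 12 `BalabanUVNodesN16AtRRec12On` (p474753; through it dag-n22-e's `RRec₁₂On`,
`rateStub_rRec₁₂On_iff`, `rRec₁₂On_mono`, `rRec₁₂_le_rRec₁₂On_true`, `RRec₁₂`, `readingOfRecord₁₂`, RR-1's `ne3ConstLayerOfRecord₁₁`) and dag-n16-c's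
`BalabanUVNodesN16HolderDefs` (p478789: `CovRootHolder`, `N16HolderAt`, `S_N16Holder`, `s_N16Holder_of_s_N16`).  Restates nothing; cites by name.

WHY (dag-n16-c LOCATED-N16-HOLDER-PIN, repair R-β; its INTENT-1 column (A)–(D) LANDED p478789 · p479891 · p480313 · p480764; INTENT-2 (E) `…N16HolderRegime` = the
bundle-level packaging; this seat's ANSWER-N16C (E), pub-ymgap INBOX 2026-08-27T01:09Z: «n16-e takes (F) = the Holder stub at the homes of record»).  If the planner
adopts R-β, K3′'s composer reads `S_N16Holder β₀ (RRec₁₂On 𝔯 Rg)` for a printed `β₀ ∈ (2∕3, 1)` where today it reads `S_N16 (RRec₁₂On 𝔯 Rg)`.  The HOME-side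
bookkeeping this seat gave the stub of record (files 5, 8, 9, 11, 12) is repeated here ONCE, β-generic, down to the named reading of record — independent of (E):
only `N16HolderAt` ∕ `S_N16Holder` are used.  The slot-level closers at exponent β (`LeafSlotHolder`, `InEndRegimeH`, the window recipe at β) follow in file 16
once (E) lands.  At `β = 1` every statement below is the statement of record (`N16HolderDefs.s_N16Holder_one_iff`).

CONTENT ([bookkeeping]; each ONE application or a five-line unfolding).
§1 `s_N16Holder_rRec₁₂On_iff` (guarded θ-form, `rateStub_rRec₁₂On_iff`), `s_N16Holder_rRec₁₂_iff`; `s_N16Holder_rRec₁₂On_anti`, `s_N16Holder_rRec₁₂_of_rRec₁₂On_true`;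
   the weakening `s_N16Holder_rRec₁₂On_of_s_N16` ∕ `s_N16Holder_rRec₁₂_of_s_N16` (`β ≤ 1`, non-negative Hölder letter on the reading's NE3 layers).
§2 constant NE3 layer `o F`: `s_N16Holder_rRec₁₂On_iff_of_constLayer`, `s_N16Holder_rRec₁₂_iff_of_constLayer` (ONE `N16HolderAt` per guarded family ∕ per family
   with a datum of record).
§3 at `readingOfRecord₁₂ w1 ℓ₃ ne2 ne1`: `s_N16Holder_rRec₁₂On_readingOfRecord₁₂_iff`, `s_N16Holder_rRec₁₂_readingOfRecord₁₂_iff`, the read-outs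
   `n16HolderAt_of_s_N16Holder_rRec₁₂On_readingOfRecord₁₂` ∕ `…rRec₁₂…`, N21's face `covRootHolder_rRec₁₂On_readingOfRecord₁₂` (the β-root at RR-1's period
   `2·L^m`, letters `ℓ₃ F`, data `ne3DomOfRecord₁₁ F N 0 0`), the two homes agree `s_N16Holder_rRec₁₂On_readingOfRecord₁₂_of_rRec₁₂`, and the weakening at the
   reading `s_N16Holder_readingOfRecord₁₂_of_s_N16(On)` (`β ≤ 1`, `0 ≤ (ℓ₃ F).Λ₂'`).

HONEST FRAMING.  Kernel bookkeeping over dag-n22-e's homes and dag-n16-c's candidate wording; `S_N16Holder β` is a CANDIDATE stub shape for the located repair R-β —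
the statement edit is the planner's ∕ director's (R-β ∕ R-Δ ∕ R-min UNRULED); nothing of record is edited; nothing of Bałaban's asserted; no inhabitant of
`IsDatumOfRecord₁₂C` claimed (K0′ open); **N16 ∕ NE3 NOT discharged**; count-neutral; one finite four-torus at fixed ε — NOT ℝ⁴, NOT infinite volume, NOT OS, NOT a
mass gap, NOT Clay.
-/

set_option autoImplicit false

open scoped BigOperators Matrix Matrix.Norms.L2Operator

namespace Summit.QuantumFields.YangMills.BalabanUVNodes.N16HolderAtRecord12

open Literature.MathematicalPhysics.QuantumFieldTheory.Balaban1983to89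
open Literature.MathematicalPhysics.QuantumFieldTheory.Balaban1983to89.T4Continuum (T4Family ULoop)
open Node00 (IsDatumOfRecord₁₂C Stage12Params NE3Objects₁₁ NE3Letters₁₁ NE2Objects₁₁ ne3LOfRecord₁₁ ne3ConstLayerOfRecord₁₁ ne3NperOfRecord₁₁ ne3DomOfRecord₁₁)
open Summit.QuantumFields.BalabanUV.T4Continuum
open MinimalActionRate (sfClass)
open YMDAG.UVSplit (Datum NE1pCarriers RateCarriers S_N16 ne3OfRecord₁₁ RateReading₁₂ RRec₁₂ RRec₁₂On rateStub_rRec₁₂On_iff rRec₁₂On_mono rRec₁₂_le_rRec₁₂On_true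
  readingOfRecord₁₂)
open Summit.QuantumFields.YangMills.BalabanUVNodes.N16HolderDefs (CovRootHolder N16HolderAt S_N16Holder s_N16Holder_of_s_N16)

noncomputable section

variable {N : ℕ} [NeZero N] (β : ℝ) (𝔯 : RateReading₁₂ N) (Rg : (F : T4Family) → Stage12Params F N → Prop)

/-! ## §1 Master faces, regime monotonicity, the `β ≤ 1` weakening -/

/-- **`S_N16Holder β` AT THE REGIME-RESTRICTED HOME — GUARDED θ-FORM**: `S_N16Holder β (RRec₁₂On 𝔯 Rg)` iff for every family, every admissible Stage-12 tuple `θ` with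
provisos `hP` in `Rg`, every `(g₀, os)` and run length `k`, `N16HolderAt (ne3OfRecord₁₁ F ((𝔯.lit F θ hP g₀ os).ne3 k)) β` (dag-n22-e's `rateStub_rRec₁₂On_iff`). [folklore] -/
theorem s_N16Holder_rRec₁₂On_iff :
    S_N16Holder β (RRec₁₂On 𝔯 Rg) ↔ ∀ (F : T4Family) (θ : Stage12Params F N) (hP : θ.Provisos₁₂ F N), Rg F θ → θ.Admissible F N →
      ∀ (g₀ : ℕ → ℝ) (os : List (ULoop F)) (k : ℕ), N16HolderAt (ne3OfRecord₁₁ F ((𝔯.lit F θ hP g₀ os).ne3 k)) β :=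
  rateStub_rRec₁₂On_iff 𝔯 Rg fun _ R => N16HolderAt R.ne3 β

/-- **`S_N16Holder β` AT THE CANONICAL HOME**: iff for every family, datum with its Stage-12 key `h`, `(g₀, os)` and run length `k`,
`N16HolderAt (ne3OfRecord₁₁ F ((𝔯.lit F h.params h.provisos g₀ os).ne3 k)) β`. [folklore] -/
theorem s_N16Holder_rRec₁₂_iff :
    S_N16Holder β (RRec₁₂ 𝔯) ↔ ∀ (F : T4Family) (D : Datum F N) (h : IsDatumOfRecord₁₂C F N D) (g₀ : ℕ → ℝ) (os : List (ULoop F)) (k : ℕ),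
      N16HolderAt (ne3OfRecord₁₁ F ((𝔯.lit F h.params h.provisos g₀ os).ne3 k)) β := by
  constructor
  · intro hS F D h g₀ os k
    exact hS F D g₀ os _ ⟨h, k, rfl⟩
  · rintro hS F D g₀ os R ⟨h, k, rfl⟩
    exact hS F D h g₀ os k

/-- **ANTITONE IN THE REGIME**: a larger regime asks more. [folklore] -/
theorem s_N16Holder_rRec₁₂On_anti {Rg Rg' : (F : T4Family) → Stage12Params F N → Prop} (h : ∀ F θ, Rg F θ → Rg' F θ) (hS : S_N16Holder β (RRec₁₂On 𝔯 Rg')) :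
    S_N16Holder β (RRec₁₂On 𝔯 Rg) :=
  fun F D g₀ os R hR => hS F D g₀ os R (rRec₁₂On_mono 𝔯 h hR)

/-- **THE TRIVIAL REGIME COVERS THE CANONICAL HOME**. [folklore] -/
theorem s_N16Holder_rRec₁₂_of_rRec₁₂On_true (hS : S_N16Holder β (RRec₁₂On 𝔯 fun _ _ => True)) : S_N16Holder β (RRec₁₂ 𝔯) :=
  fun F D g₀ os R hR => hS F D g₀ os R (rRec₁₂_le_rRec₁₂On_true 𝔯 hR)

/-- **THE `β ≤ 1` WEAKENING AT THE REGIME-RESTRICTED HOME**: the stub of record implies the candidate stub for every `β ≤ 1`, provided the reading's NE3 layers carry a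
non-negative Hölder letter (`N16HolderDefs.s_N16Holder_of_s_N16`; the block factor `F.L ≥ 2` is the family's). [folklore] -/
theorem s_N16Holder_rRec₁₂On_of_s_N16 (hβ : β ≤ 1)
    (hΛ : ∀ (F : T4Family) (θ : Stage12Params F N) (hP : θ.Provisos₁₂ F N) (g₀ : ℕ → ℝ) (os : List (ULoop F)) (k : ℕ), 0 ≤ ((𝔯.lit F θ hP g₀ os).ne3 k).Λ₂')
    (hS : S_N16 (RRec₁₂On 𝔯 Rg)) : S_N16Holder β (RRec₁₂On 𝔯 Rg) :=
  s_N16Holder_of_s_N16 hS hβ fun F D g₀ os R hR => by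
    obtain ⟨θ, hP, -, -, -, k, rfl⟩ := hR
    exact ⟨le_trans one_le_two (HistoryFlow.two_le_L F), hΛ F θ hP g₀ os k⟩

/-- **THE `β ≤ 1` WEAKENING AT THE CANONICAL HOME**. [folklore] -/
theorem s_N16Holder_rRec₁₂_of_s_N16 (hβ : β ≤ 1)
    (hΛ : ∀ (F : T4Family) (θ : Stage12Params F N) (hP : θ.Provisos₁₂ F N) (g₀ : ℕ → ℝ) (os : List (ULoop F)) (k : ℕ), 0 ≤ ((𝔯.lit F θ hP g₀ os).ne3 k).Λ₂')
    (hS : S_N16 (RRec₁₂ 𝔯)) : S_N16Holder β (RRec₁₂ 𝔯) :=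
  s_N16Holder_of_s_N16 hS hβ fun F D g₀ os R hR => by
    obtain ⟨h, k, rfl⟩ := hR
    exact ⟨le_trans one_le_two (HistoryFlow.two_le_L F), hΛ F h.params h.provisos g₀ os k⟩

/-! ## §2 Readings with a constant NE3 layer -/

section ConstLayer

variable (o : T4Family → NE3Objects₁₁ N)

/-- **FOR A READING WHOSE NE3 COMPONENT IS CONSTANTLY `o F`, `S_N16Holder β (RRec₁₂On 𝔯 Rg)` IS ONE `N16HolderAt … β` PER GUARDED FAMILY.** [folklore] -/
theorem s_N16Holder_rRec₁₂On_iff_of_constLayer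
    (hpin : ∀ (F : T4Family) (θ : Stage12Params F N) (hP : θ.Provisos₁₂ F N) (g₀ : ℕ → ℝ) (os : List (ULoop F)) (k : ℕ), (𝔯.lit F θ hP g₀ os).ne3 k = o F) :
    S_N16Holder β (RRec₁₂On 𝔯 Rg) ↔ ∀ (F : T4Family), (∃ θ : Stage12Params F N, θ.Provisos₁₂ F N ∧ Rg F θ ∧ θ.Admissible F N) →
      N16HolderAt (ne3OfRecord₁₁ F (o F)) β := by
  rw [s_N16Holder_rRec₁₂On_iff]
  constructor
  · rintro h F ⟨θ, hP, hRg, hθ⟩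
    have h' := h F θ hP hRg hθ (fun _ => 0) [] 0
    rwa [hpin] at h'
  · intro h F θ hP hRg hθ g₀ os k
    rw [hpin]
    exact h F ⟨θ, hP, hRg, hθ⟩

/-- **THE SAME AT THE CANONICAL HOME**: one `N16HolderAt … β` per family carrying a Stage-12 datum of record. [folklore] -/
theorem s_N16Holder_rRec₁₂_iff_of_constLayer
    (hpin : ∀ (F : T4Family) (θ : Stage12Params F N) (hP : θ.Provisos₁₂ F N) (g₀ : ℕ → ℝ) (os : List (ULoop F)) (k : ℕ), (𝔯.lit F θ hP g₀ os).ne3 k = o F) :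
    S_N16Holder β (RRec₁₂ 𝔯) ↔ ∀ (F : T4Family), (∃ D : Datum F N, IsDatumOfRecord₁₂C F N D) → N16HolderAt (ne3OfRecord₁₁ F (o F)) β := by
  rw [s_N16Holder_rRec₁₂_iff]
  constructor
  · rintro h F ⟨D, hD⟩
    have h' := h F D hD (fun _ => 0) [] 0
    rwa [hpin] at h'
  · intro h F D hD g₀ os k
    rw [hpin]
    exact h F ⟨D, hD⟩

end ConstLayer

/-! ## §3 At the named reading of record `readingOfRecord₁₂ w1 ℓ₃ ne2 ne1` -/

section ReadingOfRecord

variable (w1 : (F : T4Family) → (θ : Stage12Params F N) → Node00.W1.ReadingData F (Node00.MatA N) θ.τ9.M) (ℓ₃ : T4Family → NE3Letters₁₁)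
  (ne2 : (F : T4Family) → Stage12Params F N → (ℕ → ℝ) → List (ULoop F) → ℕ → NE2Objects₁₁)
  (ne1 : (F : T4Family) → Stage12Params F N → (ℕ → ℝ) → List (ULoop F) → NE1pCarriers)

/-- **`S_N16Holder β` AT THE READING OF RECORD, REGIME-RESTRICTED HOME** IS «`N16HolderAt (ne3OfRecord₁₁ F (ne3ConstLayerOfRecord₁₁ F N (ℓ₃ F))) β` for every family carrying
an admissible Stage-12 tuple with provisos in `Rg`» (`hpin := rfl`). [folklore] -/
theorem s_N16Holder_rRec₁₂On_readingOfRecord₁₂_iff :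
    S_N16Holder β (RRec₁₂On (readingOfRecord₁₂ w1 ℓ₃ ne2 ne1) Rg) ↔ ∀ (F : T4Family), (∃ θ : Stage12Params F N, θ.Provisos₁₂ F N ∧ Rg F θ ∧ θ.Admissible F N) →
      N16HolderAt (ne3OfRecord₁₁ F (ne3ConstLayerOfRecord₁₁ F N (ℓ₃ F))) β :=
  s_N16Holder_rRec₁₂On_iff_of_constLayer β _ Rg (fun F => ne3ConstLayerOfRecord₁₁ F N (ℓ₃ F)) fun _ _ _ _ _ _ => rfl

/-- **`S_N16Holder β` AT THE READING OF RECORD, CANONICAL HOME** IS «`N16HolderAt … β` for every family carrying a Stage-12 datum of record». [folklore] -/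
theorem s_N16Holder_rRec₁₂_readingOfRecord₁₂_iff :
    S_N16Holder β (RRec₁₂ (readingOfRecord₁₂ w1 ℓ₃ ne2 ne1)) ↔ ∀ (F : T4Family), (∃ D : Datum F N, IsDatumOfRecord₁₂C F N D) →
      N16HolderAt (ne3OfRecord₁₁ F (ne3ConstLayerOfRecord₁₁ F N (ℓ₃ F))) β :=
  s_N16Holder_rRec₁₂_iff_of_constLayer β _ (fun F => ne3ConstLayerOfRecord₁₁ F N (ℓ₃ F)) fun _ _ _ _ _ _ => rfl

/-- **THE `h16` READ-OUT AT THE READING OF RECORD, REGIME-RESTRICTED**. [folklore] -/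
theorem n16HolderAt_of_s_N16Holder_rRec₁₂On_readingOfRecord₁₂ (hS : S_N16Holder β (RRec₁₂On (readingOfRecord₁₂ w1 ℓ₃ ne2 ne1) Rg)) (F : T4Family)
    {θ : Stage12Params F N} (hP : θ.Provisos₁₂ F N) (hRg : Rg F θ) (hθ : θ.Admissible F N) :
    N16HolderAt (ne3OfRecord₁₁ F (ne3ConstLayerOfRecord₁₁ F N (ℓ₃ F))) β :=
  (s_N16Holder_rRec₁₂On_readingOfRecord₁₂_iff β Rg w1 ℓ₃ ne2 ne1).1 hS F ⟨θ, hP, hRg, hθ⟩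

/-- **THE `h16` READ-OUT AT THE READING OF RECORD, CANONICAL HOME**. [folklore] -/
theorem n16HolderAt_of_s_N16Holder_rRec₁₂_readingOfRecord₁₂ (hS : S_N16Holder β (RRec₁₂ (readingOfRecord₁₂ w1 ℓ₃ ne2 ne1))) (F : T4Family) {D : Datum F N}
    (hD : IsDatumOfRecord₁₂C F N D) : N16HolderAt (ne3OfRecord₁₁ F (ne3ConstLayerOfRecord₁₁ F N (ℓ₃ F))) β :=
  (s_N16Holder_rRec₁₂_readingOfRecord₁₂_iff β w1 ℓ₃ ne2 ne1).1 hS F ⟨D, hD⟩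

/-- **N21's FACE AT EXPONENT `β` AT THE READING OF RECORD, REGIME-RESTRICTED**: under the candidate stub, at every guarded family the β-root `CovRootHolder` at RR-1's period
`ne3NperOfRecord₁₁ F 0 0 = 2·L^m`, the letters `ℓ₃ F` and the data of record `ne3DomOfRecord₁₁ F N 0 0` (`N16HolderAt` unfolded — what dag-n21-d's `…N21HolderWidth`
reads). [folklore] -/
theorem covRootHolder_rRec₁₂On_readingOfRecord₁₂ (hS : S_N16Holder β (RRec₁₂On (readingOfRecord₁₂ w1 ℓ₃ ne2 ne1) Rg)) (F : T4Family)
    {θ : Stage12Params F N} (hP : θ.Provisos₁₂ F N) (hRg : Rg F θ) (hθ : θ.Admissible F N) :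
    CovRootHolder 4 (sfClass 4 (ne3LOfRecord₁₁ F) (ne3NperOfRecord₁₁ F 0 0) (ℓ₃ F).ε) (ne3LOfRecord₁₁ F) (ne3NperOfRecord₁₁ F 0 0) (ℓ₃ F).b (ℓ₃ F).g (ℓ₃ F).C
      (ℓ₃ F).Λ₁ (ℓ₃ F).Λ₂' β (ne3DomOfRecord₁₁ F N 0 0) :=
  n16HolderAt_of_s_N16Holder_rRec₁₂On_readingOfRecord₁₂ β Rg w1 ℓ₃ ne2 ne1 hS F hP hRg hθ

/-- **THE TWO HOMES AGREE AT THE READING OF RECORD — CANONICAL ⇒ REGIME-RESTRICTED, EVERY REGIME**: a guarded family carries the datum of record `datumOfRecord₁₂ F N θ hP`,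
so the canonical home's sentence covers it. [folklore] -/
theorem s_N16Holder_rRec₁₂On_readingOfRecord₁₂_of_rRec₁₂ (hS : S_N16Holder β (RRec₁₂ (readingOfRecord₁₂ w1 ℓ₃ ne2 ne1))) :
    S_N16Holder β (RRec₁₂On (readingOfRecord₁₂ w1 ℓ₃ ne2 ne1) Rg) :=
  (s_N16Holder_rRec₁₂On_readingOfRecord₁₂_iff β Rg w1 ℓ₃ ne2 ne1).2 fun F ⟨θ, hP, _, hθ⟩ =>
    (s_N16Holder_rRec₁₂_readingOfRecord₁₂_iff β w1 ℓ₃ ne2 ne1).1 hS F ⟨_, Node00.isDatumOfRecord₁₂C_datumOfRecord₁₂ F N θ hP hθ⟩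

/-- **THE `β ≤ 1` WEAKENING AT THE READING OF RECORD, REGIME-RESTRICTED**: `S_N16 → S_N16Holder β` for `β ≤ 1` whenever the letters carry a non-negative Hölder letter
`0 ≤ (ℓ₃ F).Λ₂'`. [folklore] -/
theorem s_N16Holder_readingOfRecord₁₂_of_s_N16On (hβ : β ≤ 1) (hΛ : ∀ F : T4Family, 0 ≤ (ℓ₃ F).Λ₂')
    (hS : S_N16 (RRec₁₂On (readingOfRecord₁₂ w1 ℓ₃ ne2 ne1) Rg)) : S_N16Holder β (RRec₁₂On (readingOfRecord₁₂ w1 ℓ₃ ne2 ne1) Rg) :=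
  s_N16Holder_rRec₁₂On_of_s_N16 β _ Rg hβ (fun F _ _ _ _ _ => hΛ F) hS

/-- **THE `β ≤ 1` WEAKENING AT THE READING OF RECORD, CANONICAL HOME**. [folklore] -/
theorem s_N16Holder_readingOfRecord₁₂_of_s_N16 (hβ : β ≤ 1) (hΛ : ∀ F : T4Family, 0 ≤ (ℓ₃ F).Λ₂')
    (hS : S_N16 (RRec₁₂ (readingOfRecord₁₂ w1 ℓ₃ ne2 ne1))) : S_N16Holder β (RRec₁₂ (readingOfRecord₁₂ w1 ℓ₃ ne2 ne1)) :=
  s_N16Holder_rRec₁₂_of_s_N16 β _ hβ (fun F _ _ _ _ _ => hΛ F) hS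

end ReadingOfRecord

end

end Summit.QuantumFields.YangMills.BalabanUVNodes.N16HolderAtRecord12
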